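import Literature.NumberTheory.Sieve.Maynard2016Prop92LocalPairSumTotal
import Literature.NumberTheory.Sieve.FGKMT2018MainTermRegroup
import HarnessLib

/-!
# Maynard 2016, Proposition 9.2 for `𝒜 = ℤ` — the regrouped quadratic form (leaf M1, display (9.15))

Sources: J. Maynard, *Dense clusters of primes in subsets*, Compositio Math. 152 (2016) 1517–1554 =
arXiv:1405.2593 [Maynard2016DenseClusters], proof of Proposition 9.2, pp. 21–22 (displays
(9.9)–(9.15)); K. Ford, B. Green, S. Konyagin, J. Maynard, T. Tao, *Long gaps between primes*,
JAMS 31 (2018) [FordGreenKonyaginMaynardTao2018], Theorem 6 (7.13).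

Step (R), closing the exact-algebra leaf **`Maynard2016Prop92Regroup`** (M1) of
`Maynard2016Prop92MainDecomposition`: with (S) `primeQF_eq_sum_yVarM` (display (9.11)),
(V)/(P) `localPairSumM_eq_zero_of_prod_ne` and (T) `sum_localPairSumM_eq_phiOmega`,
`Q_m = ∑_{r} (y^{(m)}_r)²/φ_ω(r) + ∑_{r,s} y^{(m)}_r (y^{(m)}_s − y^{(m)}_r) T^{(m)}(r,s)/φ_ω(r)²`
(`primeQF = ySqSumM + ediffM`) — the `φ_L`-twisted twin of `FGKMT2018MainTermRegroup.quadForm_regroup`.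
The vectors `r` with `∏ rᵢ > R` carry `y^{(m)}_r = 0` (`yVarM_eq_zero_of_floor_lt`, since `λ_d = 0`
for `∏ dᵢ > R`), which is where the size hypothesis of (T) comes from.

* `maynard2016Prop92Regroup_holds : Maynard2016Prop92Regroup`.

## References
* J. Maynard, *Dense clusters of primes in subsets*, Compositio Math. 152 (2016), proof of Prop. 9.2
  pp. 21–22, (9.9)–(9.15) [Maynard2016DenseClusters].
* K. Ford, B. Green, S. Konyagin, J. Maynard, T. Tao, *Long gaps between primes*, JAMS 31 (2018),
  Thm 6 (7.13) [FordGreenKonyaginMaynardTao2018].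
-/

noncomputable section

open Finset
open scoped ArithmeticFunction.Moebius

namespace Literature.NumberTheory.Sieve

namespace FGKMT2018

variable {k : ℕ}

/-- `λ_d = 0` for `d ∈ 𝒟_k` with `∏ dᵢ > ⌊R⌋` (every `r ⊇ d` has `y_r = 0`: off the simplex).
[cite: Maynard2016DenseClusters, (8.6) p. 14 («λ_d supported on d ≤ R»)] -/
theorem lamVar_eq_zero_of_floor_lt {L : Fin k → ℤ × ℤ} {B : ℕ} {R : ℝ} (hR : 1 < R)
    (F : (Fin k → ℝ) → ℝ) {d : Fin k → ℕ} (h : ⌊R⌋₊ < ∏ i, d i) :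
    lamVar L B R F d = 0 := by
  unfold lamVar
  rw [Finset.sum_eq_zero, mul_zero]
  intro r hr
  obtain ⟨hrbox, hdr⟩ := Finset.mem_filter.1 hr
  have hr1 : ∀ i, 1 ≤ r i := one_le_of_mem_dkBox hrbox
  have hle : (∏ i, d i) ≤ ∏ i, r i :=
    Nat.le_of_dvd (Finset.prod_pos fun i _ => hr1 i) (Finset.prod_dvd_prod_of_dvd _ _ fun i _ => hdr i)
  rw [yVar_eq_zero_of_floor_lt hR hr1 (lt_of_lt_of_le h hle), zero_div]

/-- `y^{(m)}_r = 0` for `∏ rᵢ > ⌊R⌋` (every `d ⊇ r` has `λ_d = 0`).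
[cite: Maynard2016DenseClusters, proof of Prop. 9.2 p. 21, (9.10)] -/
theorem yVarM_eq_zero_of_floor_lt {L : Fin k → ℤ × ℤ} {B : ℕ} {R : ℝ} (hR : 1 < R)
    (F : (Fin k → ℝ) → ℝ) (m : Fin k) {r : Fin k → ℕ} (h : ⌊R⌋₊ < ∏ i, r i) :
    yVarM L B R F m r = 0 := by
  unfold yVarM
  rw [Finset.sum_eq_zero, mul_zero]
  intro d hd
  obtain ⟨hdP, hrd⟩ := Finset.mem_filter.1 hd
  have hd1 : ∀ i, 1 ≤ d i := one_le_of_mem_dkBox (dkBoxP_subset L B R m hdP)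
  have hle : (∏ i, r i) ≤ ∏ i, d i :=
    Nat.le_of_dvd (Finset.prod_pos fun i _ => hd1 i) (Finset.prod_dvd_prod_of_dvd _ _ fun i _ => hrd i)
  rw [lamVar_eq_zero_of_floor_lt hR F (lt_of_lt_of_le h hle), zero_div]

/-- Per-`r` regrouping: `∑_s y^{(m)}_r y^{(m)}_s T^{(m)}(r,s)/(φ_ω(r)φ_ω(s))
= (y^{(m)}_r)²/φ_ω(r) + ∑_s y^{(m)}_r (y^{(m)}_s − y^{(m)}_r) T^{(m)}(r,s)/φ_ω(r)²` (`r ∈ dkBoxP`).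
[cite: Maynard2016DenseClusters, proof of Prop. 9.2 p. 22, (9.13)–(9.15)] -/
theorem sum_yVarM_mul_localPairSumM_eq {L : Fin k → ℤ × ℤ} (hadm : FormsAdmissible L) {B : ℕ}
    {R : ℝ} (hR : 1 < R) (F : (Fin k → ℝ) → ℝ) (m : Fin k) {r : Fin k → ℕ}
    (hr : r ∈ dkBoxP L B R m) :
    ∑ s ∈ dkBoxP L B R m, yVarM L B R F m r * yVarM L B R F m s /
        (phiOmega L (∏ i, r i) * phiOmega L (∏ i, s i)) * localPairSumM L B R m r s =
      yVarM L B R F m r ^ 2 / phiOmega L (∏ i, r i) +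
        ∑ s ∈ dkBoxP L B R m, yVarM L B R F m r * (yVarM L B R F m s - yVarM L B R F m r) /
          phiOmega L (∏ i, r i) ^ 2 * localPairSumM L B R m r s := by
  classical
  by_cases hbig : ⌊R⌋₊ < ∏ i, r i
  · have hy : yVarM L B R F m r = 0 := yVarM_eq_zero_of_floor_lt hR F m hbig
    simp [hy]
  · have hT := sum_localPairSumM_eq_phiOmega hadm hr (not_lt.1 hbig)
    have hterm : ∀ s ∈ dkBoxP L B R m,
        yVarM L B R F m r * yVarM L B R F m s / (phiOmega L (∏ i, r i) * phiOmega L (∏ i, s i)) *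
            localPairSumM L B R m r s =
          yVarM L B R F m r ^ 2 / phiOmega L (∏ i, r i) ^ 2 * localPairSumM L B R m r s +
            yVarM L B R F m r * (yVarM L B R F m s - yVarM L B R F m r) /
              phiOmega L (∏ i, r i) ^ 2 * localPairSumM L B R m r s := by
      intro s hs
      by_cases hT0 : localPairSumM L B R m r s = 0
      · simp [hT0]
      · have heq : (∏ i, s i) = ∏ i, r i := by
          by_contra hne
          exact hT0 (localPairSumM_eq_zero_of_prod_ne (hadm.1 m) hr hs (fun h => hne h.symm))
        rw [heq]
        ring
    rw [Finset.sum_congr rfl hterm, Finset.sum_add_distrib, ← Finset.mul_sum, hT]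
    congr 1
    by_cases hφ : phiOmega L (∏ i, r i) = 0
    · simp [hφ]
    · rw [show phiOmega L (∏ i, r i) ^ 2 = phiOmega L (∏ i, r i) * phiOmega L (∏ i, r i) from
        pow_two _, ← div_div, div_mul_cancel₀ _ hφ]

/-- **The regrouped form (display (9.15) with its difference terms)**, exact:
`Q_m = ∑_r (y^{(m)}_r)²/φ_ω(r) + ∑_{r,s} y^{(m)}_r (y^{(m)}_s − y^{(m)}_r) T^{(m)}(r,s)/φ_ω(r)²`.
[cite: Maynard2016DenseClusters, proof of Prop. 9.2 pp. 21–22, (9.9)–(9.15); FordGreenKonyaginMaynardTao2018, Thm 6 (7.13)] -/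
theorem primeQF_regroup {L : Fin k → ℤ × ℤ} (hadm : FormsAdmissible L) (B : ℕ) {R : ℝ}
    (hR : 1 < R) (F : (Fin k → ℝ) → ℝ) (m : Fin k) :
    primeQF L B R F m = ySqSumM L B R F m + ediffM L B R F m := by
  unfold ySqSumM ediffM
  rw [primeQF_eq_sum_yVarM hadm B R F m, ← Finset.sum_add_distrib]
  exact Finset.sum_congr rfl fun r hr => sum_yVarM_mul_localPairSumM_eq hadm hR F m hr

end FGKMT2018

/-- **Leaf M1 of `Maynard2016Prop92MainDecomposition` holds**: the exact regrouping
`primeQF = ySqSumM + ediffM` (displays (9.9)–(9.15)).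
[cite: Maynard2016DenseClusters, proof of Prop. 9.2 pp. 21–22, (9.9)–(9.15); FordGreenKonyaginMaynardTao2018, Thm 6 (7.13)] -/
theorem maynard2016Prop92Regroup_holds : Maynard2016Prop92Regroup :=
  fun _k _L hadm B _R hR F m => FGKMT2018.primeQF_regroup hadm B hR F m

/-- **`Maynard2016Prop92Regroup` holds** (leaf M1 of `Maynard2016Prop92MainDecomposition`: the exact
regrouping `Q_m = ∑_r (y_r)²/φ_ω(r) + ∑_{r,s} y_r (y_s − y_r) T(r,s)/φ_ω(r)²` of the proof of Maynard 2016
Prop. 9.2, displays (9.9)–(9.15)) — the exact-name `_holds` alias of `maynard2016Prop92Regroup_holds`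
above (appended 2026-08-29, flt-inv gen 70; D-0026 bookkeeping: the proof term is the existing theorem of
this file; no statement, definition or attribute is edited; no new named fact; the ledger's debt table
listed the fact unproved at +60 min, `ledger fact claim` GRANTED 2026-08-29T16:20Z).
[cite: Maynard2016DenseClusters, proof of Prop. 9.2 pp. 21–22, (9.9)–(9.15); FordGreenKonyaginMaynardTao2018, Thm 6 (7.13)] -/
theorem Maynard2016Prop92Regroup_holds :
    _root_.Literature.NumberTheory.Sieve.Maynard2016Prop92Regroup :=
  _root_.Literature.NumberTheory.Sieve.maynard2016Prop92Regroup_holds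

end Literature.NumberTheory.Sieve
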